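import Summits.Langlands.Langlands.Theorems.ParityBlindBianchiIcosahedralDescentLevelMain

/-!
# `IcosahedralDescentLevelR` (stmt-Langlands-16620, D′R of route ParityBlindBianchi, rev 10)

The restated uniform-descent item D′R (the hypothesis `∃ S₀` now carries `(0 : ℕ) ∉ S₀`), proved
CONDITIONALLY on the tree's four Arthur–Clozel named facts

* F1 `Literature.NumberTheory.Automorphic.cuspidal_descent_cyclic` (A–C Ch. 3 Thm 4.2 (d)),
* F2 `Literature.NumberTheory.Automorphic.ArthurClozel1989_strongLifting_unramified` (Thm 5.1),
* F3 `Literature.NumberTheory.Automorphic.baseChange_cyclic_cuspidal` (Thm 4.2 (a)),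
* F4 `Literature.NumberTheory.Automorphic.ArthurClozel_fibres_quadratic` (Thm 3.1),

by the landed `icosahedralDescentLevel_conditional`
(`Theorems/ParityBlindBianchiIcosahedralDescentLevelMain.lean`), whose conclusion after the four
facts is this item's signature verbatim.  Trust base of the result: exactly these four names
(`proof.conditional`); the item's own signature is NOT proved unconditionally here.
-/

-- `Summit.Langlands.Langlands.…`: the repeated path component is the tree's layout (D-0017).
set_option linter.dupNamespace false

namespace Summit.Langlands.Langlands.Theorems.IcosahedralDescentLevelR

/-- **D′R from F1–F4.**  The signature of item stmt-Langlands-16620 (`IcosahedralDescentLevelR`: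
uniform quadratic descent `ℚ ← K` for an irreducible icosahedral `ρ`, bad set `S₀ ∌ 0` uniform over
all imaginary quadratic `K` with `2` split) with the four Arthur–Clozel base-change facts of the
tree as hypotheses (trust base exactly these four names; `proof.conditional`).  When the route
file renders `Theses.ParityBlindBianchi.IcosahedralDescentLevelR` (rev 10), the by-name form is
this theorem verbatim (the decl unfolds to this statement). [folklore] -/
theorem icosahedralDescentLevelR_of_facts
    (h₁ : Literature.NumberTheory.Automorphic.cuspidal_descent_cyclic)
    (h₂ : Literature.NumberTheory.Automorphic.ArthurClozel1989_strongLifting_unramified)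
    (h₃ : Literature.NumberTheory.Automorphic.baseChange_cyclic_cuspidal)
    (h₄ : Literature.NumberTheory.Automorphic.ArthurClozel_fibres_quadratic) :
    ∀ (ι : PadicAlgCl 2 ≃+* ℂ) (ρ : Literature.NumberTheory.GaloisRepresentations.FramedGaloisRep ℚ ℂ 2), ρ.toGaloisRep.IsIrreducible → Nonempty ((Matrix.ProjGenLinGroup.mk.comp ρ.toMonoidHom).range ≃* alternatingGroup (Fin 5)) → (∃ S₀ : Finset ℕ, (0 : ℕ) ∉ S₀ ∧ ∀ (K : Type) [Field K] [NumberField K], NumberField.IsTotallyComplex K → Module.finrank ℚ K = 2 → (∃ v w : IsDedekindDomain.HeightOneSpectrum (NumberField.RingOfIntegers K), v ≠ w ∧ ((2 : ℕ) : NumberField.RingOfIntegers K) ∈ v.asIdeal ∧ ((2 : ℕ) : NumberField.RingOfIntegers K) ∈ w.asIdeal) → ∃ (σ : Literature.NumberTheory.GaloisRepresentations.FramedGaloisRep K (PadicAlgCl 2) 2) (hcpt : Literature.NumberTheory.Automorphic.isCompact_glFiniteIntegralLevel 2 K) (π : Literature.NumberTheory.Automorphic.CuspidalAutomorphicRepData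 2 K hcpt), (∀ (g : Field.absoluteGaloisGroup K) (i j : Fin 2), ι ((σ g).val i j) = ((Literature.NumberTheory.GaloisRepresentations.FramedGaloisRep.restrictField K ρ) g).val i j) ∧ ∀ w : IsDedekindDomain.HeightOneSpectrum (NumberField.RingOfIntegers K), (∀ ℓ ∈ S₀, ((ℓ : ℕ) : NumberField.RingOfIntegers K) ∉ w.asIdeal) → Summit.Langlands.SatakeFrobCompatibleAt ι π.1 σ w) → ∃ (hcpt : Literature.NumberTheory.Automorphic.isCompact_glFiniteIntegralLevel 2 ℚ) (π : Literature.NumberTheory.Automorphic.CuspidalAutomorphicRepData 2 ℚ hcpt), (∀ᶠ v : IsDedekindDomain.HeightOneSpectrum (NumberField.RingOfIntegers ℚ) in Filter.cofinite, ∃ α : Multiset ℂ, π.1.HasSatakeParamAt v α ∧ ρ.IsUnramifiedAt v ∧ ρ.HasFrobCharpolyAt v (Literature.NumberTheory.Automorphic.satakePolynomial α)) :=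
  Summit.Langlands.Langlands.Theorems.IcosahedralDescentLevel.icosahedralDescentLevel_conditional
    h₁ h₂ h₃ h₄

end Summit.Langlands.Langlands.Theorems.IcosahedralDescentLevelR
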